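import Literature.MathematicalPhysics.QuantumLattice.MerminWagnerEquilibriumStates2D
import HarnessLib

/-!
# Quasi-two-dimensional (layered) models: the `U(1)` order parameter of every translation-invariant equilibrium state is
# `O(√(β / log(1/ε_⊥)))` — a rigorous Mermin–Wagner upper bound on the ordering temperature of weakly coupled layers

Topic `Literature/MathematicalPhysics/QuantumLattice` (family `hubbard`; sequel of `MerminWagnerCriterionEquilibriumStates` /
`MerminWagnerEquilibriumStates2D`).

The Mermin–Wagner mechanism does not forbid order in `d = 3`, but it makes the order parameter of a stack of two-dimensional layers
with weak interlayer coupling `ε_⊥` small unless `β ≳ log(1/ε_⊥)`: this is the rigorous content of the familiar estimate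
`T_c ≲ const / log(J/J_⊥)` for quasi-two-dimensional magnets and superconductors (Klein–Landau–Shucker's Bogoliubov-inequality
argument [KleinLandauShucker1981] run with a cutoff living on finitely many layers). This file PROVES, for every Hermitian, even,
translation-covariant interaction `Ψ` of finite range `R` on `ℤ³` conserving an even Hermitian on-site charge `q`, every `β ≥ 0`,
every translation-invariant solution `ω` of the variational principle (in particular every `IsVarEquilibrium` state), every local
`O ∈ 𝔄_Λ`, `Λ ⊆ box ρ₀`, of charge `κ`, and every scale `M > 0`:

* `FermionInteraction.interlayerNorm Ψ R = ε_⊥` — the total norm `Σ ‖Φ(Z)‖` of the terms through the origin that are NOT contained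
  in a single layer `{x₂ = const}` (definition);
* `InfVolFermionState.IsTranslationInvariant.norm_sq_expect_le_layered` —
  `|κ|²|ω(O)|² ≤ β‖O‖² · 4‖q‖² |box ⌊R⌋| (2ρ₀+1) · [ S_Ψ · 32⌊R⌋²(1 + log(K + ⌊R⌋))/M² + ε_⊥ · (2N+1)² ]`,
  `N = ⌈a e^M⌉`, `a = ρ₀ + 3⌊R⌋ + 1`, `K = N + ρ₀` (`S_Ψ = Σ_{Z∋0}‖Φ(Z)‖`): the in-plane logarithmic cutoff costs `~ S_Ψ/M`, cutting
  it off across the layers costs `~ ε_⊥ a² e^{2M}`; with `e^{2M} ~ ε_⊥^{-1/2}` the order parameter is `O(β/log(1/ε_⊥))^{1/2}`;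
* `InfVolFermionState.IsVarEquilibrium.norm_sq_expect_le_layered` — the equilibrium-state form.

## Proof

`MerminWagnerCriterionEquilibriumStates.norm_sq_expect_le_of_conservedCharge` bounds `|κ|²|ω(O)|²` by
`β‖O‖²·4‖q‖² Σ_{Z} ‖Φ(Z)‖ (Σ_{x∈Z}|f(x) − c_Z|)²` for ANY cutoff `f ≡ 1` on `Λ`. Take `f(x) = g(x₀,x₁)·[|x₂| ≤ ρ₀]` with `g` the
two-dimensional logarithmic cutoff of `MerminWagnerEquilibriumStates2D`. For a term `Z` inside one layer the oscillation of `f` is that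
of `g` (modulus `b(x₀,x₁)`, summed over `2ρ₀+1` layers: the 2D Dirichlet sum `≤ 32⌊R⌋²(1+log T)/M²` each); for a term meeting two
layers we only use `|f| ≤ 1` on its support (`(2ρ₀+1)(2N+1)²` sites), and these terms carry total weight `ε_⊥` per site by
translation covariance (`sum_filter_mem_not_flat_norm_le`). Everything is PROVED (standard axioms); one definition, no named fact.

## References

* A. Klein, L. J. Landau, D. S. Shucker, J. Stat. Phys. 26 (1981) 505–512. [cite: KleinLandauShucker1981]
* F. J. Dyson, E. H. Lieb, B. Simon, J. Stat. Phys. 18 (1978) 335, §2 eq. (28). [cite: DLS1978, §2 eq. (28)]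
* H. Araki, H. Moriya, Rev. Math. Phys. 15 (2003) 93, Thm. 12.11. [cite: ArakiMoriya2003, Theorem 12.11]
-/

noncomputable section

open scoped ComplexOrder BigOperators Matrix.Norms.L2Operator
open Finset Literature.InformationTheory.Entropy

namespace Literature.MathematicalPhysics.QuantumLattice

open Matrix Literature.Probability.LatticeModels ThermodynamicLimit
open _root_.Filter
open scoped _root_.Topology

/-! ### §1 Layers of `ℤ³`: the in-plane projection, flat regions, the interlayer norm -/

/-- The in-plane coordinates `(x₀, x₁)` of a site of `ℤ³`. [cite: KleinLandauShucker1981] -/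
def planeOf (x : Site 3) : Site 2 := fun i => x (Fin.castSucc i)

/-- A region is **flat** if it lies in a single layer `{x₂ = const}` (an `abbrev`, so that the finite conjunction is decidable by
instance search). [cite: KleinLandauShucker1981] -/
abbrev IsSingleLayer (Z : Finset (Site 3)) : Prop := ∀ x ∈ Z, ∀ y ∈ Z, x 2 = y 2

/-- **The interlayer coupling norm** `ε_⊥(Ψ) = Σ_{Z ∋ 0, Z ⊆ thicken {0} R, Z not flat} ‖Φ(Z)‖`: the total strength of the terms
through the origin that couple different layers. [cite: KleinLandauShucker1981] -/
def FermionInteraction.interlayerNorm (Ψ : FermionInteraction 3) (R : ℝ) : ℝ :=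
  ∑ Z ∈ (thicken ({0} : Finset (Site 3)) R).powerset with ((0 : Site 3) ∈ Z ∧ ¬ IsSingleLayer Z), ‖Ψ.Φ Z‖

/-- `ε_⊥ ≥ 0`. [cite: KleinLandauShucker1981] -/
theorem FermionInteraction.interlayerNorm_nonneg (Ψ : FermionInteraction 3) (R : ℝ) : 0 ≤ Ψ.interlayerNorm R := by
  unfold FermionInteraction.interlayerNorm
  exact Finset.sum_nonneg fun _ _ => norm_nonneg _

/-- The in-plane projection is `1`-Lipschitz for the sup norms. [cite: BratteliRobinsonII1997, §6.2.1] -/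
theorem supNorm_planeOf_sub_le (x y : Site 3) : Site.supNorm (planeOf y - planeOf x) ≤ Site.supNorm (y - x) :=
  Site.supNorm_le_iff.2 fun i => Site.natAbs_le_supNorm (y - x) (Fin.castSucc i)

/-- `‖planeOf x‖_∞ ≤ ‖x‖_∞`. [cite: BratteliRobinsonII1997, §6.2.1] -/
theorem supNorm_planeOf_le (x : Site 3) : Site.supNorm (planeOf x) ≤ Site.supNorm x := by
  have h := supNorm_planeOf_sub_le 0 x
  simp only [sub_zero] at h
  have h0 : planeOf (0 : Site 3) = 0 := rfl
  rwa [h0, sub_zero] at h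

/-- `|x₂| ≤ ‖x‖_∞`. [cite: BratteliRobinsonII1997, §6.2.1] -/
theorem natAbs_apply_two_le (x : Site 3) : (x 2).natAbs ≤ Site.supNorm x := Site.natAbs_le_supNorm x 2

/-- A site of `ℤ³` is determined by its plane coordinates and its height. [folklore] -/
private theorem eq_of_planeOf_eq {x y : Site 3} (hp : planeOf x = planeOf y) (hh : x 2 = y 2) : x = y := by
  funext i
  refine Fin.lastCases ?_ (fun j => ?_) i
  · exact hh
  · exact congr_fun hp j

/-- Flatness is translation invariant. [cite: KleinLandauShucker1981] -/
theorem isSingleLayer_shiftSet_iff (v : Site 3) (Z : Finset (Site 3)) : IsSingleLayer (shiftSet v Z) ↔ IsSingleLayer Z := by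
  constructor
  · intro h x hx y hy
    have := h (x + v) (PolySite.add_mem_shiftSet v hx) (y + v) (PolySite.add_mem_shiftSet v hy)
    simpa using this
  · intro h x hx y hy
    rw [mem_shiftSet] at hx hy
    have := h _ hx _ hy
    simpa [sub_eq_iff_eq_add] using this

/-- **Each site carries interlayer norm mass at most `ε_⊥`**: for a translation-covariant interaction of finite range `R`,
`Σ_{Z ⊆ Λ', Z ∋ y, Z not flat} ‖Φ(Z)‖ ≤ ε_⊥(Ψ)`. [cite: BratteliRobinsonII1997, §6.2.1] -/
theorem FermionInteraction.IsTranslationInvariant.sum_filter_mem_not_flat_norm_le {Ψ : FermionInteraction 3} {R : ℝ}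
    (hT : Ψ.IsTranslationInvariant) (hR : Ψ.HasFiniteRange R) (y : Site 3) (Λ' : Finset (Site 3)) :
    ∑ Z ∈ Λ'.powerset with (y ∈ Z ∧ ¬ IsSingleLayer Z), ‖Ψ.Φ Z‖ ≤ Ψ.interlayerNorm R := by
  classical
  set φ : Finset (Site 3) → ℝ := fun Z => if ¬ IsSingleLayer Z then ‖Ψ.Φ Z‖ else 0 with hφ
  have hsplit' : ∀ (S : Finset (Site 3)) (z : Site 3),
      ∑ Z ∈ S.powerset with (z ∈ Z ∧ ¬ IsSingleLayer Z), ‖Ψ.Φ Z‖ = ∑ Z ∈ S.powerset with z ∈ Z, φ Z := by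
    intro S z
    rw [Finset.sum_filter, Finset.sum_filter]
    refine Finset.sum_congr rfl fun Z _ => ?_
    by_cases h1 : z ∈ Z <;> by_cases h2 : IsSingleLayer Z <;> simp [hφ, h1, h2]
  have hφ0 : ∀ Z, Ψ.Φ Z = 0 → φ Z = 0 := fun Z hZ => by simp [hφ, hZ]
  have hφnn : ∀ Z, 0 ≤ φ Z := fun Z => by simp only [hφ]; split_ifs <;> first | exact norm_nonneg _ | exact le_rfl
  rw [hsplit' Λ' y]
  unfold FermionInteraction.interlayerNorm
  rw [hsplit' (thicken ({0} : Finset (Site 3)) R) 0]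
  calc ∑ Z ∈ Λ'.powerset with y ∈ Z, φ Z
      ≤ ∑ Z ∈ (Λ' ∪ thicken ({y} : Finset (Site 3)) R).powerset with y ∈ Z, φ Z :=
        Finset.sum_le_sum_of_subset_of_nonneg (Finset.filter_subset_filter _ (Finset.powerset_mono.2 Finset.subset_union_left))
          fun _ _ _ => hφnn _
    _ = ∑ Z ∈ (thicken ({y} : Finset (Site 3)) R).powerset with y ∈ Z, φ Z :=
        hR.sum_filter_mem_eq_sum_thicken_singleton _ hφ0 Finset.subset_union_right
    _ = ∑ Z ∈ (thicken ({0} : Finset (Site 3)) R).powerset with (0 : Site 3) ∈ Z, φ (shiftSet y Z) :=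
        sum_thicken_singleton_eq_sum_shiftSet _ y R
    _ ≤ _ := Finset.sum_le_sum fun Z _ => by
        simp only [hφ, isSingleLayer_shiftSet_iff]
        split_ifs <;> first | exact le_rfl | (rw [hT y Z]; exact norm_fermionEmbed_le _ _)

/-! ### §2 The layered cutoff and its termwise bound -/

section LayeredCutoff

variable {a r ρ₀ : ℕ} {M : ℝ}

/-- **The layered cutoff** `f(x) = g(x₀,x₁)·[|x₂| ≤ ρ₀]`, `g` the two-dimensional logarithmic cutoff. [cite: KleinLandauShucker1981] -/
def layeredCutoff (a ρ₀ : ℕ) (M : ℝ) (x : Site 3) : ℝ :=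
  if (x 2).natAbs ≤ ρ₀ then logCutoff a M (planeOf x) else 0

/-- Its in-plane modulus on the slab `|x₂| ≤ ρ₀`, `0` outside. [cite: KleinLandauShucker1981] -/
def layeredModulus (a r ρ₀ : ℕ) (M : ℝ) (x : Site 3) : ℝ :=
  if (x 2).natAbs ≤ ρ₀ then logCutoffModulus a r M (planeOf x) else 0

/-- The support indicator: `|x₂| ≤ ρ₀` and `(x₀,x₁)` in the box of radius `N`. [cite: KleinLandauShucker1981] -/
def layeredSupport (ρ₀ N : ℕ) (x : Site 3) : ℝ :=
  if (x 2).natAbs ≤ ρ₀ ∧ planeOf x ∈ box 2 N then 1 else 0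

/-- `0 ≤ f ≤ 1`. [cite: KleinLandauShucker1981] -/
theorem layeredCutoff_mem_Icc (a ρ₀ : ℕ) (M : ℝ) (x : Site 3) : layeredCutoff a ρ₀ M x ∈ Set.Icc (0 : ℝ) 1 := by
  unfold layeredCutoff
  split_ifs
  · exact logCutoff_mem_Icc a M _
  · exact ⟨le_rfl, zero_le_one⟩

/-- Off the support the cutoff vanishes: `f(x) ≠ 0 ⇒ layeredSupport x = 1` (`N ≥ a e^M`). [cite: KleinLandauShucker1981] -/
theorem abs_layeredCutoff_le_layeredSupport (ha : 1 ≤ a) (hM : 0 < M) {N : ℕ} (hN : (a : ℝ) * Real.exp M ≤ N) (x : Site 3) :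
    |layeredCutoff a ρ₀ M x| ≤ layeredSupport ρ₀ N x := by
  unfold layeredCutoff layeredSupport
  by_cases hh : (x 2).natAbs ≤ ρ₀
  · rw [if_pos hh]
    by_cases hb : planeOf x ∈ box 2 N
    · rw [if_pos ⟨hh, hb⟩, abs_le]
      have h := logCutoff_mem_Icc a M (planeOf x)
      exact ⟨by linarith [h.1], h.2⟩
    · rw [if_neg (fun h => hb h.2)]
      rw [mem_box_iff_supNorm_le, not_le] at hb
      have : (a : ℝ) * Real.exp M ≤ Site.supNorm (planeOf x) := hN.trans (by exact_mod_cast hb.le)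
      rw [logCutoff_eq_zero ha hM this, abs_zero]
  · rw [if_neg hh, abs_zero]
    split_ifs
    · exact zero_le_one
    · exact le_rfl

/-- In a flat region the layered cutoff oscillates like the planar one: `|f(x) − f(z)| ≤ layeredModulus x` for `x, z` in the same layer
with `‖z − x‖_∞ ≤ r` (`a ≥ 3r`). [cite: KleinLandauShucker1981] -/
theorem abs_layeredCutoff_sub_le_modulus (ha : 1 ≤ a) (har : 3 * r ≤ a) (hM : 0 < M) {x z : Site 3} (hxz : x 2 = z 2)
    (hd : z - x ∈ box 3 r) : |layeredCutoff a ρ₀ M x - layeredCutoff a ρ₀ M z| ≤ layeredModulus a r ρ₀ M x := by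
  unfold layeredCutoff layeredModulus
  have hzz : (z 2).natAbs = (x 2).natAbs := by rw [hxz]
  by_cases hh : (x 2).natAbs ≤ ρ₀
  · rw [if_pos hh, if_pos (hzz ▸ hh), if_pos hh]
    refine abs_logCutoff_sub_le_modulus ha har hM ?_
    rw [mem_box_iff_supNorm_le] at hd ⊢
    exact (supNorm_planeOf_sub_le x z).trans hd
  · rw [if_neg hh, if_neg (hzz ▸ hh), if_neg hh, sub_zero, abs_zero]

/-- `0 ≤ layeredModulus`. [cite: KleinLandauShucker1981] -/
theorem layeredModulus_nonneg (a r ρ₀ : ℕ) (hM : 0 < M) (x : Site 3) : 0 ≤ layeredModulus a r ρ₀ M x := by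
  unfold layeredModulus
  split_ifs
  · exact logCutoffModulus_nonneg a r hM _
  · exact le_rfl

/-- `0 ≤ layeredSupport ≤ 1` and it is idempotent. [cite: KleinLandauShucker1981] -/
theorem layeredSupport_sq (ρ₀ N : ℕ) (x : Site 3) : layeredSupport ρ₀ N x ^ 2 = layeredSupport ρ₀ N x := by
  unfold layeredSupport
  split_ifs <;> norm_num

/-- `0 ≤ layeredSupport`. [cite: KleinLandauShucker1981] -/
theorem layeredSupport_nonneg (ρ₀ N : ℕ) (x : Site 3) : 0 ≤ layeredSupport ρ₀ N x := by
  unfold layeredSupport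
  split_ifs
  · exact zero_le_one
  · exact le_rfl

end LayeredCutoff

/-! ### §3 Sums over slabs of `ℤ³` reduce to planar sums -/

/-- **A slab sum is at most `(2ρ₀+1)` planar sums**: for `g ≥ 0`,
`Σ_{x ∈ S, |x₂| ≤ ρ₀} g(x₀,x₁) ≤ (2ρ₀+1) Σ_{y ∈ box T} g(y)` provided the plane coordinates of `S` lie in `box T`.
[cite: BratteliRobinsonII1997, §6.2.1] -/
theorem sum_slab_le (S : Finset (Site 3)) (ρ₀ T : ℕ) (hS : ∀ x ∈ S, Site.supNorm (planeOf x) ≤ T) {g : Site 2 → ℝ}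
    (hg : ∀ y, 0 ≤ g y) :
    ∑ x ∈ S, (if (x 2).natAbs ≤ ρ₀ then g (planeOf x) else 0) ≤ (2 * ρ₀ + 1) * ∑ y ∈ box 2 T, g y := by
  classical
  rw [← Finset.sum_filter]
  set S' := S.filter fun x => (x 2).natAbs ≤ ρ₀ with hS'
  set ι : Site 3 → Site 2 × ℤ := fun x => (planeOf x, x 2) with hι
  have hinj : Set.InjOn ι S' := fun x _ y _ hxy => by
    simp only [hι, Prod.mk.injEq] at hxy
    exact eq_of_planeOf_eq hxy.1 hxy.2
  have himg : S'.image ι ⊆ box 2 T ×ˢ Finset.Icc (-(ρ₀ : ℤ)) ρ₀ := by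
    intro p hp
    rw [Finset.mem_image] at hp
    obtain ⟨x, hx, rfl⟩ := hp
    rw [hS', Finset.mem_filter] at hx
    refine Finset.mem_product.2 ⟨mem_box_iff_supNorm_le.2 (hS x hx.1), Finset.mem_Icc.2 ?_⟩
    show -(ρ₀ : ℤ) ≤ x 2 ∧ x 2 ≤ ρ₀
    have := hx.2
    omega
  calc ∑ x ∈ S', g (planeOf x) = ∑ p ∈ S'.image ι, g p.1 := by
        rw [Finset.sum_image hinj]
    _ ≤ ∑ p ∈ box 2 T ×ˢ Finset.Icc (-(ρ₀ : ℤ)) ρ₀, g p.1 := Finset.sum_le_sum_of_subset_of_nonneg himg fun _ _ _ => hg _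
    _ = (2 * ρ₀ + 1) * ∑ y ∈ box 2 T, g y := by
        rw [Finset.sum_product]
        have hc : ∀ y ∈ box 2 T, ∑ z ∈ Finset.Icc (-(ρ₀ : ℤ)) ρ₀, g (y, z).1 = (2 * ρ₀ + 1) * g y := by
          intro y _
          show ∑ z ∈ Finset.Icc (-(ρ₀ : ℤ)) ρ₀, g y = _
          rw [Finset.sum_const, Int.card_Icc, nsmul_eq_mul, show ((ρ₀ : ℤ) + 1 - -(ρ₀ : ℤ)).toNat = 2 * ρ₀ + 1 by omega]
          push_cast
          ring
        rw [Finset.sum_congr rfl hc, ← Finset.mul_sum]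

/-- `‖x‖_∞ ≤ max(‖(x₀,x₁)‖_∞, |x₂|)`. [cite: BratteliRobinsonII1997, §6.2.1] -/
theorem supNorm_le_max_planeOf (x : Site 3) : Site.supNorm x ≤ max (Site.supNorm (planeOf x)) (x 2).natAbs := by
  rw [Site.supNorm_le_iff]
  intro i
  refine Fin.lastCases ?_ (fun j => ?_) i
  · exact le_max_right _ _
  · exact (Site.natAbs_le_supNorm (planeOf x) j).trans (le_max_left _ _)

/-- Exchange of summations with a per-site budget: `Σ_{Z⊆S} φ(Z) Σ_{x∈Z} g(x) ≤ B Σ_{x∈S} g(x)` if every site carries `φ`-mass `≤ B`.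
[cite: BratteliRobinsonII1997, §6.2.1] -/
private theorem sum_powerset_mul_sum_le {S : Finset (Site 3)} (φ : Finset (Site 3) → ℝ) (g : Site 3 → ℝ) (hg : ∀ x, 0 ≤ g x)
    {B : ℝ} (hB : ∀ x ∈ S, ∑ Z ∈ S.powerset with x ∈ Z, φ Z ≤ B) :
    ∑ Z ∈ S.powerset, φ Z * ∑ x ∈ Z, g x ≤ B * ∑ x ∈ S, g x := by
  classical
  have e1 : ∀ Z ∈ S.powerset, φ Z * ∑ x ∈ Z, g x = ∑ x ∈ S, if x ∈ Z then g x * φ Z else 0 := by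
    intro Z hZ
    rw [Finset.mem_powerset] at hZ
    rw [← Finset.sum_filter, Finset.filter_mem_eq_inter, Finset.inter_eq_right.2 hZ, Finset.mul_sum]
    exact Finset.sum_congr rfl fun x _ => by ring
  rw [Finset.sum_congr rfl e1, Finset.sum_comm, Finset.mul_sum]
  refine Finset.sum_le_sum fun x hx => ?_
  have e2 : ∑ Z ∈ S.powerset, (if x ∈ Z then g x * φ Z else 0) = g x * ∑ Z ∈ S.powerset with x ∈ Z, φ Z := by
    rw [Finset.sum_filter, Finset.mul_sum]
    refine Finset.sum_congr rfl fun Z _ => ?_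
    split_ifs <;> simp
  rw [e2, mul_comm B]
  exact mul_le_mul_of_nonneg_left (hB x hx) (hg x)

/-! ### §4 The order-parameter bound for layered models -/

section Layered

variable {Ψ : FermionInteraction 3} {R : ℝ}

/-- **Termwise bound for the layered cutoff**: for a term `Φ(Z)` of a range-`R` interaction,
`‖Φ Z‖ (Σ_{x∈Z}|f x − c_Z|)² ≤ |box r| (‖Φ Z‖ Σ_{x∈Z} b̃(x)² + [Z not flat] ‖Φ Z‖ Σ_{x∈Z} s(x))` with the anchor constants
`c_Z = f(z_Z)` for flat `Z`, `0` otherwise. [cite: KleinLandauShucker1981] -/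
private theorem layered_term_le (hR : Ψ.HasFiniteRange R) {a ρ₀ N : ℕ} (ha1 : 1 ≤ a) (har : 3 * ⌊R⌋₊ ≤ a) {M : ℝ}
    (hM : 0 < M) (haN : (a : ℝ) * Real.exp M ≤ N) (Z : Finset (Site 3)) :
    ‖Ψ.Φ Z‖ * (∑ x ∈ Z, |layeredCutoff a ρ₀ M x -
        (if IsSingleLayer Z then (if h : Z.Nonempty then layeredCutoff a ρ₀ M h.choose else 0) else 0)|) ^ 2 ≤
      ((box 3 ⌊R⌋₊).card : ℝ) * (‖Ψ.Φ Z‖ * ∑ x ∈ Z, layeredModulus a ⌊R⌋₊ ρ₀ M x ^ 2) +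
        ((box 3 ⌊R⌋₊).card : ℝ) * ((if IsSingleLayer Z then 0 else ‖Ψ.Φ Z‖) * ∑ x ∈ Z, layeredSupport ρ₀ N x) := by
  classical
  have hNR0 : 0 ≤ ((box 3 ⌊R⌋₊).card : ℝ) := Nat.cast_nonneg _
  have hA0 : 0 ≤ ((box 3 ⌊R⌋₊).card : ℝ) * (‖Ψ.Φ Z‖ * ∑ x ∈ Z, layeredModulus a ⌊R⌋₊ ρ₀ M x ^ 2) :=
    mul_nonneg hNR0 (mul_nonneg (norm_nonneg _) (Finset.sum_nonneg fun x _ => sq_nonneg _))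
  by_cases hΦ : Ψ.Φ Z = 0
  · rw [hΦ, norm_zero, zero_mul, zero_mul, mul_zero, zero_add]
    split_ifs <;> simp
  by_cases hZ : Z.Nonempty
  swap
  · rw [Finset.not_nonempty_iff_eq_empty.1 hZ]; simp
  have hz₁ : hZ.choose ∈ Z := hZ.choose_spec
  have hZR : Z ⊆ thicken ({hZ.choose} : Finset (Site 3)) R := hR.subset_thicken_singleton hΦ hz₁
  have hcard : (Z.card : ℝ) ≤ ((box 3 ⌊R⌋₊).card : ℝ) := by
    exact_mod_cast (Finset.card_le_card hZR).trans (by rw [thicken_singleton_eq]; exact Finset.card_image_le)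
  have hnear : ∀ x ∈ Z, hZ.choose - x ∈ box 3 ⌊R⌋₊ := fun x hx => by
    have h := mem_thicken_singleton_iff.1 (hZR hx)
    rw [mem_box_iff_supNorm_le] at h ⊢
    rwa [← neg_sub, Site.supNorm_neg']
  by_cases hflat : IsSingleLayer Z
  · -- flat: compare with the anchor through the modulus
    rw [if_pos hflat, dif_pos hZ, if_pos hflat, zero_mul, mul_zero, add_zero]
    have h1 : ∑ x ∈ Z, |layeredCutoff a ρ₀ M x - layeredCutoff a ρ₀ M hZ.choose| ≤ ∑ x ∈ Z, layeredModulus a ⌊R⌋₊ ρ₀ M x :=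
      Finset.sum_le_sum fun x hx => abs_layeredCutoff_sub_le_modulus ha1 har hM (hflat x hx _ hz₁) (hnear x hx)
    have h0 : 0 ≤ ∑ x ∈ Z, |layeredCutoff a ρ₀ M x - layeredCutoff a ρ₀ M hZ.choose| := Finset.sum_nonneg fun _ _ => abs_nonneg _
    calc ‖Ψ.Φ Z‖ * (∑ x ∈ Z, |layeredCutoff a ρ₀ M x - layeredCutoff a ρ₀ M hZ.choose|) ^ 2
        ≤ ‖Ψ.Φ Z‖ * (Z.card * ∑ x ∈ Z, layeredModulus a ⌊R⌋₊ ρ₀ M x ^ 2) :=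
          mul_le_mul_of_nonneg_left ((pow_le_pow_left₀ h0 h1 2).trans sq_sum_le_card_mul_sum_sq) (norm_nonneg _)
      _ ≤ ‖Ψ.Φ Z‖ * (((box 3 ⌊R⌋₊).card : ℝ) * ∑ x ∈ Z, layeredModulus a ⌊R⌋₊ ρ₀ M x ^ 2) :=
          mul_le_mul_of_nonneg_left (mul_le_mul_of_nonneg_right hcard (Finset.sum_nonneg fun _ _ => sq_nonneg _)) (norm_nonneg _)
      _ = ((box 3 ⌊R⌋₊).card : ℝ) * (‖Ψ.Φ Z‖ * ∑ x ∈ Z, layeredModulus a ⌊R⌋₊ ρ₀ M x ^ 2) := by ring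
  · -- not flat: compare with `0` through the support indicator
    rw [if_neg hflat, if_neg hflat]
    have h1 : ∑ x ∈ Z, |layeredCutoff a ρ₀ M x - 0| ≤ ∑ x ∈ Z, layeredSupport ρ₀ N x :=
      Finset.sum_le_sum fun x _ => by rw [sub_zero]; exact abs_layeredCutoff_le_layeredSupport ha1 hM haN x
    have h0 : 0 ≤ ∑ x ∈ Z, |layeredCutoff a ρ₀ M x - 0| := Finset.sum_nonneg fun _ _ => abs_nonneg _
    have hss : ∑ x ∈ Z, layeredSupport ρ₀ N x ^ 2 = ∑ x ∈ Z, layeredSupport ρ₀ N x :=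
      Finset.sum_congr rfl fun x _ => layeredSupport_sq _ _ _
    calc ‖Ψ.Φ Z‖ * (∑ x ∈ Z, |layeredCutoff a ρ₀ M x - 0|) ^ 2 ≤ ‖Ψ.Φ Z‖ * (Z.card * ∑ x ∈ Z, layeredSupport ρ₀ N x ^ 2) :=
          mul_le_mul_of_nonneg_left ((pow_le_pow_left₀ h0 h1 2).trans sq_sum_le_card_mul_sum_sq) (norm_nonneg _)
      _ ≤ ‖Ψ.Φ Z‖ * (((box 3 ⌊R⌋₊).card : ℝ) * ∑ x ∈ Z, layeredSupport ρ₀ N x) := by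
          rw [hss]
          exact mul_le_mul_of_nonneg_left (mul_le_mul_of_nonneg_right hcard
            (Finset.sum_nonneg fun _ _ => layeredSupport_nonneg _ _ _)) (norm_nonneg _)
      _ ≤ _ := by linarith

/-- **THE DIRICHLET SUM OF THE LAYERED CUTOFF** over any region `S` whose sites have `‖x‖_∞ ≤ T`: with `r = ⌊R⌋`, `a ≥ 3r`,
`a ≥ 1`, `N ≥ a e^M`, there are constants `c_Z` with
`Σ_{Z ⊆ S} ‖Φ(Z)‖ (Σ_{x∈Z}|f(x) − c_Z|)² ≤ |box r| (2ρ₀+1) [S_Ψ · 32r²(1 + log T)/M² + ε_⊥ (2N+1)²]` (`f` the layered cutoff).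
[cite: KleinLandauShucker1981] -/
theorem FermionInteraction.sum_layeredCutoff_le (hT : Ψ.IsTranslationInvariant) (hR : Ψ.HasFiniteRange R) {a ρ₀ N T : ℕ}
    (ha1 : 1 ≤ a) (har : 3 * ⌊R⌋₊ ≤ a) {M : ℝ} (hM : 0 < M) (haN : (a : ℝ) * Real.exp M ≤ N)
    (S : Finset (Site 3)) (hS : ∀ x ∈ S, Site.supNorm x ≤ T) :
    ∃ c : Finset (Site 3) → ℝ,
      ∑ Z ∈ S.powerset, ‖Ψ.Φ Z‖ * (∑ x ∈ Z, |layeredCutoff a ρ₀ M x - c Z|) ^ 2 ≤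
        ((box 3 ⌊R⌋₊).card : ℝ) * (2 * ρ₀ + 1) *
          ((∑ X ∈ (thicken ({0} : Finset (Site 3)) R).powerset with (0 : Site 3) ∈ X, ‖Ψ.Φ X‖) *
              (32 * (⌊R⌋₊ : ℝ) ^ 2 * (1 + Real.log T) / M ^ 2) +
            Ψ.interlayerNorm R * (2 * (N : ℝ) + 1) ^ 2) := by
  classical
  refine ⟨fun Z => if IsSingleLayer Z then (if h : Z.Nonempty then layeredCutoff a ρ₀ M h.choose else 0) else 0, ?_⟩
  have hNR0 : 0 ≤ ((box 3 ⌊R⌋₊).card : ℝ) := Nat.cast_nonneg _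
  refine (Finset.sum_le_sum fun Z _ => layered_term_le hR ha1 har hM haN (ρ₀ := ρ₀) Z).trans ?_
  rw [Finset.sum_add_distrib, ← Finset.mul_sum, ← Finset.mul_sum]
  -- (i) intralayer: per-site budget `S_Ψ`
  have hI : ∑ Z ∈ S.powerset, ‖Ψ.Φ Z‖ * ∑ x ∈ Z, layeredModulus a ⌊R⌋₊ ρ₀ M x ^ 2 ≤
      (∑ X ∈ (thicken ({0} : Finset (Site 3)) R).powerset with (0 : Site 3) ∈ X, ‖Ψ.Φ X‖) *
        ∑ x ∈ S, layeredModulus a ⌊R⌋₊ ρ₀ M x ^ 2 :=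
    sum_powerset_mul_sum_le _ _ (fun x => sq_nonneg _) fun x _ => hT.sum_filter_mem_norm_le hR x S
  -- (ii) interlayer: per-site budget `ε_⊥`
  have hII : ∑ Z ∈ S.powerset, (if IsSingleLayer Z then 0 else ‖Ψ.Φ Z‖) * ∑ x ∈ Z, layeredSupport ρ₀ N x ≤
      Ψ.interlayerNorm R * ∑ x ∈ S, layeredSupport ρ₀ N x := by
    refine sum_powerset_mul_sum_le _ _ (fun x => layeredSupport_nonneg _ _ _) fun x _ => ?_
    have e : ∑ Z ∈ S.powerset with x ∈ Z, (if IsSingleLayer Z then 0 else ‖Ψ.Φ Z‖) =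
        ∑ Z ∈ S.powerset with (x ∈ Z ∧ ¬ IsSingleLayer Z), ‖Ψ.Φ Z‖ := by
      rw [Finset.sum_filter, Finset.sum_filter]
      refine Finset.sum_congr rfl fun Z _ => ?_
      by_cases h1 : x ∈ Z
      · by_cases h2 : IsSingleLayer Z
        · rw [if_pos h1, if_pos h2, if_neg (fun h => h.2 h2)]
        · rw [if_pos h1, if_neg h2, if_pos ⟨h1, h2⟩]
      · rw [if_neg h1, if_neg (fun h => h1 h.1)]
    rw [e]
    exact hT.sum_filter_mem_not_flat_norm_le hR x S
  -- (iii) the slab sums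
  have hplane : ∀ x ∈ S, Site.supNorm (planeOf x) ≤ T := fun x hx => (supNorm_planeOf_le x).trans (hS x hx)
  have hbm_sum : ∑ x ∈ S, layeredModulus a ⌊R⌋₊ ρ₀ M x ^ 2 ≤ (2 * ρ₀ + 1) * (32 * (⌊R⌋₊ : ℝ) ^ 2 * (1 + Real.log T) / M ^ 2) := by
    have h1 : ∑ x ∈ S, layeredModulus a ⌊R⌋₊ ρ₀ M x ^ 2 =
        ∑ x ∈ S, (if (x 2).natAbs ≤ ρ₀ then logCutoffModulus a ⌊R⌋₊ M (planeOf x) ^ 2 else 0) :=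
      Finset.sum_congr rfl fun x _ => by
        unfold layeredModulus
        split_ifs
        · rfl
        · rw [zero_pow two_ne_zero]
    rw [h1]
    refine (sum_slab_le S ρ₀ T hplane (g := fun y => logCutoffModulus a ⌊R⌋₊ M y ^ 2) fun y => sq_nonneg _).trans ?_
    have hρ : (0 : ℝ) ≤ 2 * ρ₀ + 1 := by exact_mod_cast Nat.zero_le _
    exact mul_le_mul_of_nonneg_left (sum_box_logCutoffModulus_sq_le a ⌊R⌋₊ hM T) hρ
  have hs_sum : ∑ x ∈ S, layeredSupport ρ₀ N x ≤ (2 * ρ₀ + 1) * (2 * (N : ℝ) + 1) ^ 2 := by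
    have h1 : ∑ x ∈ S, layeredSupport ρ₀ N x ≤
        ∑ x ∈ S, (if (x 2).natAbs ≤ ρ₀ then (if planeOf x ∈ box 2 N then (1 : ℝ) else 0) else 0) :=
      Finset.sum_le_sum fun x _ => by
        unfold layeredSupport
        by_cases h1 : (x 2).natAbs ≤ ρ₀
        · by_cases h2 : planeOf x ∈ box 2 N
          · rw [if_pos ⟨h1, h2⟩, if_pos h1, if_pos h2]
          · rw [if_neg (fun h => h2 h.2), if_pos h1, if_neg h2]
        · rw [if_neg (fun h => h1 h.1), if_neg h1]
    have h2 := sum_slab_le S ρ₀ T hplane (g := fun y => if y ∈ box 2 N then (1 : ℝ) else 0)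
      fun y => by split_ifs; exacts [zero_le_one, le_rfl]
    have hcount : ∑ y ∈ box 2 T, (if y ∈ box 2 N then (1 : ℝ) else 0) ≤ (2 * (N : ℝ) + 1) ^ 2 := by
      rw [Finset.sum_boole]
      have hc : ((box 2 T).filter fun y => y ∈ box 2 N).card ≤ (box 2 N).card :=
        Finset.card_le_card fun y hy => (Finset.mem_filter.1 hy).2
      rw [card_box] at hc
      have hc' : (((box 2 T).filter fun y => y ∈ box 2 N).card : ℝ) ≤ ((2 * N + 1) ^ 2 : ℕ) := by exact_mod_cast hc
      refine hc'.trans (le_of_eq ?_)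
      push_cast
      ring
    have hρ : (0 : ℝ) ≤ 2 * ρ₀ + 1 := by exact_mod_cast Nat.zero_le _
    exact h1.trans (h2.trans (mul_le_mul_of_nonneg_left hcount hρ))
  have hSΨ0 : 0 ≤ ∑ X ∈ (thicken ({0} : Finset (Site 3)) R).powerset with (0 : Site 3) ∈ X, ‖Ψ.Φ X‖ :=
    Finset.sum_nonneg fun _ _ => norm_nonneg _
  have hE0 : 0 ≤ Ψ.interlayerNorm R := Ψ.interlayerNorm_nonneg R
  have hA := mul_le_mul_of_nonneg_left (hI.trans (mul_le_mul_of_nonneg_left hbm_sum hSΨ0)) hNR0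
  have hB := mul_le_mul_of_nonneg_left (hII.trans (mul_le_mul_of_nonneg_left hs_sum hE0)) hNR0
  refine (add_le_add hA hB).trans (le_of_eq ?_)
  ring

variable (hH : Ψ.IsHermitian) (hE : Ψ.IsEven) (hT : Ψ.IsTranslationInvariant) (hR : Ψ.HasFiniteRange R) {β : ℝ} (hβ : 0 ≤ β)
  {ω : InfVolFermionState 3}
include hH hE hT hR hβ

/-- **THE ORDER PARAMETER OF A LAYERED (QUASI-TWO-DIMENSIONAL) MODEL IS CONTROLLED BY THE INTERLAYER COUPLING.** Let `Ψ` be a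
Hermitian, even, translation-covariant interaction of finite range `R` on `ℤ³` each of whose terms conserves the even Hermitian on-site
charge `q`; let `β ≥ 0`, `ω` a translation-invariant solution of the variational principle, `O ∈ 𝔄_Λ` with `Λ ⊆ box ρ₀` and
`Q_Λ O − O Q_Λ = κO`. Then for every in-plane radius `a ≥ ρ₀ + 3⌊R⌋ + 1`, every scale `M > 0` and every `N ≥ a e^M`:
`|κ|²|ω(O)|² ≤ β‖O‖² · 4‖q‖² · |box ⌊R⌋| (2ρ₀+1) · [S_Ψ · 32⌊R⌋²(1 + log(N + ρ₀ + ⌊R⌋))/M² + ε_⊥(Ψ) · (2N+1)²]`.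
With `N ≍ a e^M` and `e^{2M} ≍ ε_⊥^{-1/2}` this is `|ω(O)|² = O(β / log(1/ε_⊥))`: the ordering temperature of weakly coupled layers is
at most `O(1/log(1/ε_⊥))` (a rigorous Mermin–Wagner bound; for `ε_⊥ = 0`, `M → ∞` it recovers `ω(O) = 0`).
[cite: KleinLandauShucker1981] [cite: DLS1978, §2 eq. (28)] [cite: ArakiMoriya2003, Theorem 12.11] -/
theorem InfVolFermionState.IsTranslationInvariant.norm_sq_expect_le_layered (hω : ω.IsTranslationInvariant)
    (hS : Tendsto (fun n : ℕ => vonNeumannEntropy (ω.rdm (halfOpenBox 3 n)) / ((n : ℝ) ^ 3)) atTop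
      (𝓝 (Ψ.freePressure β + β * ω.meanEnergy Ψ R)))
    {q : FermionOp ({0} : Finset (Site 3))} (hq : q.IsHermitian) (hqe : parityAut q = q)
    (hcons : ∀ Z : Finset (Site 3), Commute (chargeSum q Z) (Ψ.Φ Z))
    {Λ : Finset (Site 3)} {ρ₀ : ℕ} (hΛ : Λ ⊆ box 3 ρ₀) (O : FermionOp Λ) {κ : ℂ} (hO : chargeSum q Λ * O - O * chargeSum q Λ = κ • O)
    {a N : ℕ} (ha : ρ₀ + 3 * ⌊R⌋₊ + 1 ≤ a) {M : ℝ} (hM : 0 < M) (haN : (a : ℝ) * Real.exp M ≤ N) :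
    ‖κ‖ ^ 2 * ‖ω.expect Λ O‖ ^ 2 ≤ β * ‖O‖ ^ 2 * (4 * ‖q‖ ^ 2 * (((box 3 ⌊R⌋₊).card : ℝ) * (2 * ρ₀ + 1) *
      ((∑ X ∈ (thicken ({0} : Finset (Site 3)) R).powerset with (0 : Site 3) ∈ X, ‖Ψ.Φ X‖) *
          (32 * (⌊R⌋₊ : ℝ) ^ 2 * (1 + Real.log ((N + ρ₀ + ⌊R⌋₊ : ℕ) : ℝ)) / M ^ 2) +
        Ψ.interlayerNorm R * (2 * (N : ℝ) + 1) ^ 2))) := by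
  classical
  have ha1 : 1 ≤ a := by omega
  have har : 3 * ⌊R⌋₊ ≤ a := by omega
  have hS' : ∀ x ∈ thicken (box 3 (N + ρ₀)) R, Site.supNorm x ≤ N + ρ₀ + ⌊R⌋₊ := fun x hx =>
    mem_box_iff_supNorm_le.1 (thicken_box_subset (N + ρ₀) R hx)
  obtain ⟨c, hc⟩ := Ψ.sum_layeredCutoff_le hT hR (ρ₀ := ρ₀) ha1 har hM haN _ hS'
  have h₁ : Λ ⊆ box 3 (N + ρ₀) := hΛ.trans (box_mono 3 (by omega))
  -- `f ≡ 1` on `Λ`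
  have hf1 : ∀ x ∈ Λ, layeredCutoff a ρ₀ M x = 1 := by
    intro x hx
    have hxρ : Site.supNorm x ≤ ρ₀ := mem_box_iff_supNorm_le.1 (hΛ hx)
    unfold layeredCutoff
    rw [if_pos ((natAbs_apply_two_le x).trans hxρ)]
    exact logCutoff_eq_one ha1 hM ((supNorm_planeOf_le x).trans (hxρ.trans (by omega)))
  -- `f ≡ 0` off `box (N + ρ₀)`
  have hf0 : ∀ x ∉ box 3 (N + ρ₀), layeredCutoff a ρ₀ M x = 0 := by
    intro x hx
    rw [mem_box_iff_supNorm_le, not_le] at hx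
    unfold layeredCutoff
    split_ifs with hh
    · refine logCutoff_eq_zero ha1 hM (haN.trans ?_)
      have hmax := supNorm_le_max_planeOf x
      have : N < Site.supNorm (planeOf x) := by
        rcases le_max_iff.1 hmax with h | h
        · omega
        · omega
      exact_mod_cast this.le
    · rfl
  have hmain := hω.norm_sq_expect_le_of_conservedCharge (by norm_num) hH hE hT hR hβ hS hq hqe hcons O hO h₁ hf1 hf0 c
  refine hmain.trans (mul_le_mul_of_nonneg_left (mul_le_mul_of_nonneg_left ?_ (by positivity)) (by positivity))
  exact_mod_cast hc

/-- **Equilibrium-state form of the layered bound.** [cite: KleinLandauShucker1981] [cite: ArakiMoriya2003, Theorem 12.11] -/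
theorem InfVolFermionState.IsVarEquilibrium.norm_sq_expect_le_layered (h : ω.IsVarEquilibrium β Ψ R)
    {q : FermionOp ({0} : Finset (Site 3))} (hq : q.IsHermitian) (hqe : parityAut q = q)
    (hcons : ∀ Z : Finset (Site 3), Commute (chargeSum q Z) (Ψ.Φ Z))
    {Λ : Finset (Site 3)} {ρ₀ : ℕ} (hΛ : Λ ⊆ box 3 ρ₀) (O : FermionOp Λ) {κ : ℂ} (hO : chargeSum q Λ * O - O * chargeSum q Λ = κ • O)
    {a N : ℕ} (ha : ρ₀ + 3 * ⌊R⌋₊ + 1 ≤ a) {M : ℝ} (hM : 0 < M) (haN : (a : ℝ) * Real.exp M ≤ N) :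
    ‖κ‖ ^ 2 * ‖ω.expect Λ O‖ ^ 2 ≤ β * ‖O‖ ^ 2 * (4 * ‖q‖ ^ 2 * (((box 3 ⌊R⌋₊).card : ℝ) * (2 * ρ₀ + 1) *
      ((∑ X ∈ (thicken ({0} : Finset (Site 3)) R).powerset with (0 : Site 3) ∈ X, ‖Ψ.Φ X‖) *
          (32 * (⌊R⌋₊ : ℝ) ^ 2 * (1 + Real.log ((N + ρ₀ + ⌊R⌋₊ : ℕ) : ℝ)) / M ^ 2) +
        Ψ.interlayerNorm R * (2 * (N : ℝ) + 1) ^ 2))) :=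
  h.1.norm_sq_expect_le_layered hH hE hT hR hβ (h.tendsto_boxEntropy_div (by norm_num) hH hE hT hR hβ) hq hqe hcons hΛ O hO ha hM haN

end Layered

end Literature.MathematicalPhysics.QuantumLattice

end
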